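import Summits.CriticalPhenomena.PercolationContinuityZ3.Theorems.PercLowPointHalfSpaceTallClusterMassBoundReplicaOverlapGlue

/-!
# `TallClusterMassBound` (stmt-CriticalPhenomena-0912), line `replica-overlap-cs-transfer` — the two-scale door (T)

Companion of `PercLowPointHalfSpaceTallClusterMassBoundReplicaOverlapGlue.lean` (same namespace, same vocabulary):

* `tallClusterMassBound_of_twoScaleShellOverlap` : at `p_c(ℤ³)`, the REGULARITY-FREE two-scale overlap bound (T)
  `Σ_{x ∈ B_n ∖ B_{⌊n/2⌋}} P(0 ↔_ℍ x, arm_R)² ≤ C n^{5/2} π_s(R)²` for all `1 ≤ n ≤ R` ALONE implies the crux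
  `TallClusterMassBound` (shell-wise Cauchy–Schwarz + geometric series; no wall-arm regularity).
* `topShellOverlap_of_condOverlap`, `topShellOverlap_of_twoScaleShellOverlap` : the global conditional overlap
  (CSB) and (T) each contain the top-shell hypothesis of
  `tallClusterMassBound_of_topShellOverlap_of_wallArmLowerRegularity` — the nesting of the line's doors.

(T) is open; heuristically it carries B's bulk-density content at the top shell AND pinned upper
quasi-multiplicativity `P(0 ↔_ℍ x, arm_R) ≲ P(0 ↔_ℍ x, arm_n) π_s(R)/π_s(n)` on the lower shells; it is false at
`p = 1` like the crux (skeleton `twoScaleShellOverlap_false_at_one`). Adapted from the registered skeleton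
`Cruxes/TallClusterMassBound/Lines/replica-overlap-cs-transfer.lean` (`massBoundAt_of_twoScaleShellOverlap`).
-/

noncomputable section

open MeasureTheory Finset Filter
open Literature.Probability.Percolation Literature.Probability.LatticeModels
open Summit.CriticalPhenomena.PercolationContinuityZ3.Theses.PercLowPointHalfSpace (TallClusterMassBound)
open Summit.CriticalPhenomena.PercolationContinuityZ3.Theorems.TallClusterMassBound.Negative

namespace Summit.CriticalPhenomena.PercolationContinuityZ3.Theorems.TallClusterMassBound.ReplicaOverlap

/-- **THE REGULARITY-FREE TWO-SCALE VARIANT (T) ALONE IMPLIES THE CRUX.** At `p_c(ℤ³)`: if the overlap of two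
independent R-TALL wall clusters on the shell of every radius `n ≤ R` satisfies
`Σ_{x ∈ B_n ∖ B_{⌊n/2⌋}} P(0 ↔_ℍ x, arm_R)² ≤ C n^{5/2} π_s(R)²`, then `TallClusterMassBound`:
on shell `n = R/2^i` Cauchy–Schwarz gives `≤ √(27C) n^{11/4} π_s(R) ≤ √(27C) 2^{-11i/4} R^{11/4} π_s(R)`;
sum the geometric series. (T) hides the cross-scale content in its lower shells (pinned upper
quasi-multiplicativity) and is false at `p = 1` like the crux. (Adapted from the skeleton's
`massBoundAt_of_twoScaleShellOverlap`.) [folklore] -/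
theorem tallClusterMassBound_of_twoScaleShellOverlap :
    (∃ C : ℝ, ∀ n R : ℕ, 1 ≤ n → n ≤ R →
      ∑ x ∈ annulus 3 (n / 2) n, ((Pp (criticalProbI 3)).real (conn x ∩ arm R)) ^ 2
        ≤ C * (n : ℝ) ^ ((5 : ℝ) / 2) * (armProb (criticalProbI 3) R) ^ 2) →
    TallClusterMassBound := by
  rintro ⟨CF, hF⟩
  refine tallClusterMassBound_iff.2 ?_
  set p : unitInterval := criticalProbI 3 with hp
  set K : ℝ := Real.sqrt (27 * max CF 0) with hK
  set δ : ℝ := (11 : ℝ) / 4 with hδdef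
  have hδ : 0 < δ := by rw [hδdef]; norm_num
  set q : ℝ := ((2 : ℝ) ^ δ)⁻¹ with hq
  have hq1 : q < 1 := inv_lt_one_of_one_lt₀ (Real.one_lt_rpow (by norm_num) hδ)
  have hq0 : 0 ≤ q := by positivity
  have hK0 : 0 ≤ K := Real.sqrt_nonneg _
  refine ⟨1 + K * (1 - q)⁻¹, fun R hR => ?_⟩
  have hR0 : (0 : ℝ) < R := by exact_mod_cast hR
  have hπR := armProb_nonneg p R
  refine mass_le_of_shell_le_geometric p hR hK0 hq0 hq1 fun i => ?_
  set n : ℕ := R / 2 ^ i with hn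
  have hrhs0 : 0 ≤ K * q ^ i * ((R : ℝ) ^ ((11 : ℝ) / 4) * armProb p R) := by positivity
  rcases Nat.eq_zero_or_pos n with hn0 | hnpos
  · have hn1 : R / 2 ^ (i + 1) = 0 := by rw [← div_two_pow_div_two, ← hn, hn0]
    rw [hn1, hn0]
    simp only [annulus, sdiff_self, Finset.bot_eq_empty, Finset.sum_empty]
    exact hrhs0
  · have hn1 : 1 ≤ n := hnpos
    have hnR : n ≤ R := Nat.div_le_self _ _
    have hn0r : (0 : ℝ) < n := by exact_mod_cast hn1
    have step2 : ∑ x ∈ annulus 3 (n / 2) n, (Pp p).real (conn x ∩ arm R)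
        ≤ K * (n : ℝ) ^ ((11 : ℝ) / 4) * armProb p R :=
      sum_le_of_sum_sq_le hn1 (card_annulus_le_cube hn1 _) (fun _ => measureReal_nonneg) hπR
        (hF n R hn1 hnR)
    have hsf : ((n : ℝ) / R) ^ δ ≤ q ^ i := by
      have := div_pow_rpow_le_inv_pow (i := i) hδ.le hR
      rwa [← hn] at this
    have hpow : (n : ℝ) ^ ((11 : ℝ) / 4) = ((n : ℝ) / R) ^ δ * (R : ℝ) ^ ((11 : ℝ) / 4) := by
      rw [hδdef, Real.div_rpow hn0r.le hR0.le, div_mul_cancel₀]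
      exact (Real.rpow_pos_of_pos hR0 _).ne'
    rw [← div_two_pow_div_two, ← hn]
    calc ∑ x ∈ annulus 3 (n / 2) n, (Pp p).real (conn x ∩ arm R)
        ≤ K * (n : ℝ) ^ ((11 : ℝ) / 4) * armProb p R := step2
      _ = K * (((n : ℝ) / R) ^ δ * (R : ℝ) ^ ((11 : ℝ) / 4)) * armProb p R := by rw [hpow]
      _ ≤ K * (q ^ i * (R : ℝ) ^ ((11 : ℝ) / 4)) * armProb p R := by
          have hRp : 0 ≤ (R : ℝ) ^ ((11 : ℝ) / 4) := by positivity
          exact mul_le_mul_of_nonneg_right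
            (mul_le_mul_of_nonneg_left (mul_le_mul_of_nonneg_right hsf hRp) hK0) hπR
      _ = K * q ^ i * ((R : ℝ) ^ ((11 : ℝ) / 4) * armProb p R) := by ring

/-- (T) ⇒ the top-shell hypothesis (take `n = R`). [folklore] -/
theorem topShellOverlap_of_twoScaleShellOverlap
    (hT : ∃ C : ℝ, ∀ n R : ℕ, 1 ≤ n → n ≤ R →
      ∑ x ∈ annulus 3 (n / 2) n, ((Pp (criticalProbI 3)).real (conn x ∩ arm R)) ^ 2
        ≤ C * (n : ℝ) ^ ((5 : ℝ) / 2) * (armProb (criticalProbI 3) R) ^ 2) :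
    ∃ C : ℝ, ∀ n : ℕ, 1 ≤ n →
      ∑ x ∈ annulus 3 (n / 2) n, ((Pp (criticalProbI 3)).real (conn x ∩ arm n)) ^ 2
        ≤ C * (n : ℝ) ^ ((5 : ℝ) / 2) * (armProb (criticalProbI 3) n) ^ 2 := by
  obtain ⟨C, hC⟩ := hT
  exact ⟨C, fun n hn => hC n n hn le_rfl⟩

/-- CSB ⇒ the top-shell hypothesis (stub 1's statement): the top shell is part of the box. [folklore] -/
theorem topShellOverlap_of_condOverlap
    (hCSB : ∃ C : ℝ, ∀ n : ℕ, 1 ≤ n →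
      ∑ x ∈ box 3 n, ((Pp (criticalProbI 3)).real (conn x ∩ arm n)) ^ 2
        ≤ C * (n : ℝ) ^ ((5 : ℝ) / 2) * (armProb (criticalProbI 3) n) ^ 2) :
    ∃ C : ℝ, ∀ n : ℕ, 1 ≤ n →
      ∑ x ∈ annulus 3 (n / 2) n, ((Pp (criticalProbI 3)).real (conn x ∩ arm n)) ^ 2
        ≤ C * (n : ℝ) ^ ((5 : ℝ) / 2) * (armProb (criticalProbI 3) n) ^ 2 := by
  obtain ⟨C, hC⟩ := hCSB
  refine ⟨C, fun n hn => le_trans ?_ (hC n hn)⟩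
  exact Finset.sum_le_sum_of_subset_of_nonneg (by rw [annulus]; exact Finset.sdiff_subset)
    fun _ _ _ => sq_nonneg _

end Summit.CriticalPhenomena.PercolationContinuityZ3.Theorems.TallClusterMassBound.ReplicaOverlap
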